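import Summits.FinalStateConjecture.FinalStateConjecture.Theses.StarvedNecks
import Literature.Geometry.Lorentzian.ApproximateKerrConfiguration
import HarnessLib.Audit

/-!
# Birth skeleton (BC3) — crux `NeckGapDecay` (stmt-FinalStateConjecture-16768), route `StarvedNecks`

`Lines/birth.lean` of `Cruxes/NeckGapDecay/` (planner, skeleton-register one-shot, 2026-08-17).

The crux (rank 2, THE deciding physics of the route; = the lead census' PosGap, AUDIT-c4 §3) asks,
for every honest `C⁴` input decomposition and every hole `i`, for a hole-anchored chart `Ψg` of the
late model tube out to a wall `W ≥ 3ρᵢ + 2` which is (G1) a smooth open embedding into `d.charted`,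
(G2) equal to `Ψᵢ` inside `R₁ + 1`, (G3) `C²`-close (→ 0) to boosted Kerrᵢ on the slabs out to `W`,
(G4) with future-directed `Λᵢe₀`-lines on `R₁ ≤ r ≤ W`, and (G5) with relatively closed sub-wall
late tube portions.

## The cut (two named stubs, kernel-checked composition `NeckGapDecay_of`)

* `stub_analyticGapDecay : AnalyticGapDecay` — THE PHYSICS: (G1)(G2)(G3) with a NORMALISED wall
  (non-decreasing, slope `≤ 1/(10‖Λᵢ‖²)` in flat time, `≥ 3ρᵢ+2`, `≥ R₁+2`).  Everything the route's
  lever (Huygens at radius `ρ`, cone ledger, Klainerman–Rodnianski parametrix) has to deliver, and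
  nothing causal.  Open-problem-adjacent, XL.  The wall normalisation costs the physics nothing: above
  any continuous sublinear `3ρᵢ+2` there is a non-decreasing, `ε`-Lipschitz, still sublinear majorant
  (`W(s) = sup_{u ≥ 0} (g(s+u) − εu)`, `g` = running max), and certifying out to a larger sublinear
  wall is the same problem.
* `stub_causalHonesty : CausalHonesty` — LORENTZIAN CAUSALITY: any analytic gap certificate in any
  vacuum Cauchy development acquires (G4)(G5) from a later time `τ₂`, by sign propagation on the
  connected certified slab regions plus an imprisonment / Cauchy-time-function argument in the
  globally hyperbolic `𝒟` (`O ⊆ J⁺(ιΣ) ∩ I⁻(charted)`), with `Hc`(3) for the anchored part down to the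
  horizon.  No admissibility, maximality, genericity, `Hf` or `DV`.  L-sized; the same kind of content
  as the route's PROVED items `SeamedChartsExhaust` (causal) and `FutureOrientedOfSeamed`
  (orientation), one level down.
* `NeckGapDecay_of (hA : Registered.stub_analyticGapDecay) (hB : Registered.stub_causalHonesty) :
  NeckGapDecay` (the `Registered.stub_*` abbrevs are the two statements, by the stubs' names) — real
  proof: per hole, take the analytic certificate, the causal clauses from `τ₂ ≥ τ₁`, and re-issue the
  certificate from `τ₂`
  (the open-embedding clause (G1) is restricted to the smaller late tube via
  `IsOpenEmbedding.inclusion`; the wall, (G2), (G3) are unchanged).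

Which `Disproof` obstruction it honours: the crux dir has no `Disproof.lean` yet; of the parent crux
`NecksCertify`'s Disproof (gen 3) the relevant entries are §B/§D (the DV hypothesis — consumed by
`stub_analyticGapDecay`, whose cross-hole cone separation needs it; `stub_causalHonesty` is DV-free by
design) and §G (G4-sign / relative closedness are not free — exactly the content isolated in
`stub_causalHonesty`).  Neither stub is an instance of a landed Negative lemma
(`Theorems/NecksCertify/Negative/*`: parallel-label moats, comoving pairs — both about `d₂`-level
SEAMED clauses, absent here).
-/

noncomputable section

open scoped Manifold ContDiff Topology ENNReal
open Filter Set Topology Literature.Geometry.Lorentzian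

namespace Summit.FinalStateConjecture.FinalStateConjecture.Cruxes.NeckGapDecay.Birth

set_option linter.dupNamespace false
set_option linter.unusedVariables false

/-! ## Read-back vocabulary (verbatim the `let`-bound clauses of the route decl) -/

/-- `Hc(d, R₀)` — the HonestCore clauses of the input decomposition, verbatim the `let Hc` of
`Theses.StarvedNecks.NeckGapDecay`: (1) sub-extremal holes, `100·Mᵢ ≤ R₀`, orthochronous labels;
(2) hole-late points of `{r < ϱ}` lie in `J⁻` of every later disc `{t*ᵢ = τ₂, r ≤ ϱ}` (`ϱ ≥ R₀`);
(3) every late tube portion `{τ' ≤ t*, r ≤ ϱ(t*)}` is relatively closed in `O`;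
(4) the flat chart's `∂₀` is future-directed on late flat points. -/
def Hc (𝓢 : Spacetime.{0} 4) (O : Set 𝓢.carrier) (k : ℕ) (d : FinalStateDecomposition 𝓢 O k)
    (R₀ : ℝ) : Prop :=
  let B := d.background; let t := fun i ↦ (B i).time; let r := fun i ↦ (B i).radius; let Ψ := d.chart;
  (∀ i, Kerr.IsSubextremal (d.mass i) (d.spin i) ∧ 100 * d.mass i ≤ R₀ ∧
      0 < ((d.motion i).1 : E4 ≃L[ℝ] E4) (E4.basisVector 0) 0) ∧
  (∀ i (ϱ τ₂ : ℝ), R₀ ≤ ϱ → d.τ₀ < τ₂ →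
      Ψ i '' {x | d.τ₀ < t i x.1 ∧ t i x.1 < τ₂ ∧ r i x.1 < ϱ} ⊆
        𝓢.metric.causalPast 𝓢.timeOrientation (Ψ i '' (B i).truncTimeSlab ϱ τ₂)) ∧
  (∀ i (τ' : ℝ) (ϱ : ℝ → ℝ), Continuous ϱ → d.τ₀ < τ' →
      let A := Ψ i '' {x | τ' ≤ t i x.1 ∧ r i x.1 ≤ ϱ (t i x.1)}; closure A ∩ O ⊆ A) ∧
  (∀ y : d.flatDomain, d.τ₀ < y.1 0 →
      𝓢.timeOrientation.IsFutureDirected (mfderiv 𝓘(ℝ, E4) (𝓡 4) d.flatChart y (E4.basisVector 0)))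

/-- `Hf(d, R₀)` — the HonestFar clauses of the input decomposition, verbatim the `let Hf` of
`Theses.StarvedNecks.NeckGapDecay`: (1) flat-late points lie in `J⁻` of every later flat slab;
(2) closures of far flat slabs (`≥ 1` outside the tubes) are flat points; (3) eventually each hole
chart is `C⁰`-close (`1/(10‖Λᵢ‖²)`) to its boosted Kerr on its own Voronoi cell beyond `R₀`. -/
def Hf (𝓢 : Spacetime.{0} 4) (O : Set 𝓢.carrier) (k : ℕ) (d : FinalStateDecomposition 𝓢 O k)
    (R₀ : ℝ) : Prop :=
  let B := d.background; let t := fun i ↦ (B i).time; let r := fun i ↦ (B i).radius; let Φ := d.flatChart;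
  (∀ τ₂ : ℝ, d.τ₀ < τ₂ → Φ '' {y | d.τ₀ < y.1 0 ∧ y.1 0 < τ₂} ⊆
      𝓢.metric.causalPast 𝓢.timeOrientation (Φ '' (Minkowski.backgroundOn d.flatDomain).timeSlab τ₂)) ∧
  (∀ τ' : ℝ, d.τ₀ < τ' →
      closure (Φ '' {y | τ' ≤ y.1 0 ∧ ∀ i, d.excision i (y.1 0) + 1 ≤ r i y.1}) ⊆ Φ '' {y | τ' ≤ y.1 0}) ∧
  (∀ i, ∃ T : ℝ, supCkENorm (Subtype.val '' {x : (B i).domain | T ≤ t i x.1 ∧ R₀ ≤ r i x.1 ∧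
      ∀ j, j ≠ i → r i x.1 ≤ r j x.1}) 0 (𝓢.deviationExtend (B i) (d.chart i)) ≤
        ENNReal.ofReal (1 / (10 * ‖(((d.motion i).1 : E4 ≃L[ℝ] E4) : E4 →L[ℝ] E4)‖ ^ 2)))

/-- `DV(d)` — pairwise distinct asymptotic four-velocities `Λᵢe₀ ≠ Λⱼe₀` of the input's holes
(the antecedent inserted by the rev-2/3 repair; verbatim the crux's fourth hypothesis). -/
def DV {𝓢 : Spacetime.{0} 4} {O : Set 𝓢.carrier} {k : ℕ} (d : FinalStateDecomposition 𝓢 O k) :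
    Prop :=
  ∀ i j : Fin d.N, i ≠ j →
    ((d.motion i).1 : E4 ≃L[ℝ] E4) (E4.basisVector 0) ≠ ((d.motion j).1 : E4 ≃L[ℝ] E4) (E4.basisVector 0)

/-! ## The two pieces of a gap certificate -/

/-- **Analytic gap certificate** of hole `i` from `(R₁, τ₁, W, Ψg)` — the ANALYTIC clauses of the
crux's conclusion, with a NORMALISED wall:
* (W0) `R₀ ≤ R₁`, `τ₀ ≤ τ₁`, `W` continuous, and — the normalisation the causal lemma consumes —
  from `τ₁` on `W` is non-decreasing and slowly growing in flat time (slope `≤ 1/(10‖Λᵢ‖²)`, so that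
  the certified slab regions `{t*ᵢ = τ, R₁ ≤ rᵢ ≤ W(x⁰)}` are radially star-shaped and fixed-radius
  `Λᵢe₀`-lines never leave `{rᵢ ≤ W(x⁰)}`), with `W ≥ 3ρᵢ + 2` (the crux's wall) and `W ≥ R₁ + 2`;
* (G1) `Ψg` is a smooth open embedding of the late model tube `U = {τ₁ < t*ᵢ, rᵢ < W(x⁰)+1}` into
  `d.charted`;
* (G2) `Ψg = Ψᵢ` inside `R₁ + 1` (anchoring to the input hole chart);
* (G3) the sup-`C²` deviation of `Ψg^* g` from boosted Kerrᵢ on `{t*ᵢ = τ, rᵢ ≤ W(x⁰)}` tends to `0`.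
Nothing causal is asserted: no time orientation of the `Λᵢe₀`-lines, no relative closedness. -/
def AnalyticGapCert (𝓢 : Spacetime.{0} 4) (O : Set 𝓢.carrier) (d : FinalStateDecomposition 𝓢 O 4)
    (R₀ : ℝ) (i : Fin d.N) (R₁ τ₁ : ℝ) (W : ℝ → ℝ)
    (Ψg : (d.background i).domain → 𝓢.carrier) : Prop :=
  let B := d.background i; let t := B.time; let r := B.radius;
  R₀ ≤ R₁ ∧ d.τ₀ ≤ τ₁ ∧ Continuous W ∧
  (∀ s s' : ℝ, τ₁ ≤ s → s ≤ s' → W s ≤ W s' ∧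
      W s' ≤ W s + (s' - s) / (10 * ‖(((d.motion i).1 : E4 ≃L[ℝ] E4) : E4 →L[ℝ] E4)‖ ^ 2)) ∧
  (∀ s, τ₁ ≤ s → 3 * d.excision i s + 2 ≤ W s ∧ R₁ + 2 ≤ W s) ∧
  (let U : Set B.domain := {x | τ₁ < t x.1 ∧ r x.1 < W (x.1 0) + 1};
    ContMDiffOn 𝓘(ℝ, E4) (𝓡 4) ∞ Ψg U ∧ Topology.IsOpenEmbedding (U.restrict Ψg) ∧
      Ψg '' U ⊆ d.charted) ∧
  (∀ x : B.domain, r x.1 ≤ R₁ + 1 → Ψg x = d.chart i x) ∧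
  Tendsto (fun τ ↦ supCkENorm (Subtype.val '' {x : B.domain | t x.1 = τ ∧ r x.1 ≤ W (x.1 0)}) 2
    (𝓢.deviationExtend B Ψg)) atTop (𝓝 0)

/-- **Causal gap clauses** of hole `i` for `(R₁, τ₂, W, Ψg)` — the CAUSAL clauses of the crux's
conclusion, from time `τ₂`:
* (G4) on `{τ₂ ≤ t*ᵢ, R₁ ≤ rᵢ ≤ W(x⁰)}` the push-forward `dΨg(Λᵢe₀)` is future-directed;
* (G5) every sub-wall late tube portion `Ψg{τ' ≤ t*ᵢ, rᵢ ≤ ϱ(t*ᵢ)}` (`τ' > τ₂`, `ϱ` continuous,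
  tube inside the wall) is relatively closed in `O`. -/
def CausalGapClauses (𝓢 : Spacetime.{0} 4) (O : Set 𝓢.carrier)
    (d : FinalStateDecomposition 𝓢 O 4) (i : Fin d.N) (R₁ τ₂ : ℝ) (W : ℝ → ℝ)
    (Ψg : (d.background i).domain → 𝓢.carrier) : Prop :=
  let B := d.background i; let t := B.time; let r := B.radius;
  (∀ x : B.domain, τ₂ ≤ t x.1 → R₁ ≤ r x.1 → r x.1 ≤ W (x.1 0) →
      𝓢.timeOrientation.IsFutureDirected
        (mfderiv 𝓘(ℝ, E4) (𝓡 4) Ψg x (((d.motion i).1 : E4 ≃L[ℝ] E4) (E4.basisVector 0)))) ∧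
  (∀ (τ' : ℝ) (ϱ : ℝ → ℝ), Continuous ϱ → τ₂ < τ' →
      (∀ x : B.domain, τ' ≤ t x.1 → r x.1 ≤ ϱ (t x.1) → r x.1 ≤ W (x.1 0)) →
      closure (Ψg '' {x | τ' ≤ t x.1 ∧ r x.1 ≤ ϱ (t x.1)}) ∩ O ⊆
        Ψg '' {x | τ' ≤ t x.1 ∧ r x.1 ≤ ϱ (t x.1)})

/-! ## The two stub statements -/

/-- **Stub statement A — `AnalyticGapDecay` (THE PHYSICS; = the lead census' PosGap core with a
normalised wall; open-problem-adjacent, XL).**  For every admissible datum, MGHD `𝒟`, honest `C⁴`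
decomposition `d` of `O = exteriorOf 𝒟 d.charted` (`Hc`, `Hf`, distinct velocities `DV`) and every
hole `i`, the gap annulus is `C²`-certified ANALYTICALLY: some `(R₁, τ₁, W, Ψg)` satisfies
`AnalyticGapCert` — a hole-anchored chart, `C²`-close (→ 0) to boosted Kerrᵢ on the slabs out to a
normalised wall `W ≥ 3ρᵢ + 2`.  This is where the route's lever lives (Huygens at radius `ρ`: the
certified cylinder feeds a gap point through a Duhamel term at retarded time `→ ∞`, the backward cone
shell at radii `[4ρ, 5ρ]` lies in the flat-certified zone and is starved; Klainerman–Rodnianski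
Kirchhoff–Sobolev parametrix for `□_g Riem = Riem ⋆ Riem`; linear model landed:
`…Theorems.NecksCertifyTwoCap.Exports.huygensNeckLemma`).  Time orientation and relative closedness
are NOT part of this statement. -/
def AnalyticGapDecay : Prop :=
  ∀ (X : Type) [TopologicalSpace X] [ChartedSpace E3 X] [IsManifold (𝓡 3) ∞ X] [ConnectedSpace X]
    (D : InitialDataSet (𝓡 3) X), D ∈ admissibleVacuumData X →
    ∀ 𝒟 : VacuumCauchyDevelopment D, 𝒟.IsMaximal →
    ∀ (O : Set 𝒟.carrier) (d : FinalStateDecomposition 𝒟.toSpacetime O 4) (R₀ : ℝ),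
      O = exteriorOf 𝒟.toCauchyDevelopment d.charted →
      Hc 𝒟.toSpacetime O 4 d R₀ → Hf 𝒟.toSpacetime O 4 d R₀ → DV d →
      ∀ i : Fin d.N, ∃ (R₁ τ₁ : ℝ) (W : ℝ → ℝ) (Ψg : (d.background i).domain → 𝒟.carrier),
        AnalyticGapCert 𝒟.toSpacetime O d R₀ i R₁ τ₁ W Ψg

/-- **Stub statement B — `CausalHonesty` (LORENTZIAN CAUSALITY, no PDE, no genericity, no
admissibility, no `Hf`/`DV`; L-sized, provable from global hyperbolicity).**  In ANY vacuum Cauchy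
development `𝒟` of any datum, for a `C⁴` decomposition `d` of `O = exteriorOf 𝒟 d.charted` with
`Hc(d, R₀)` and any analytic gap certificate `(R₁, τ₁, W, Ψg)` of a hole `i`, the causal clauses hold
from some later time `τ₂ ≥ τ₁`: (G4) by a sign-propagation / imprisonment argument — `dΨg(Λᵢe₀)` is
timelike on the (radially star-shaped, hence connected) certified slab regions once the `C²`
deviation is small (`r ≥ R₁ ≥ 100Mᵢ`: Kerr`(Λe₀, Λe₀) ≤ −0.97`), so its orientation is constant
there, and PAST orientation is absurd: the fixed-radius `Λᵢe₀`-line through the anchored collar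
`R₁ ≤ r < R₁+1` (where `Ψg = Ψᵢ`, certified at all late times by the input's fixed-radius
convergence) would be a past-inextendible timelike curve of infinite length inside
`O ⊆ J⁺(ι Σ)`, against the Cauchy time function of the globally hyperbolic `𝒟`
(`CauchyDevelopment.isCauchyHypersurface`); (G5) limit points with bounded chart time are images by
continuity/compactness (and by `Hc`(3) for the anchored part inside `R₁+1`, down to the horizon),
while a limit point in `O ⊆ I⁻(charted)` of points with chart time `→ ∞` would bound the Cauchy time
of arbitrarily late points of one future-inextendible `Λᵢe₀`-line (non-imprisonment, O'Neill 14.13)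
— the forward-in-time chart-causal paths this uses stay certified exactly because the wall is
non-decreasing and slowly growing (W0). -/
def CausalHonesty : Prop :=
  ∀ (X : Type) [TopologicalSpace X] [ChartedSpace E3 X] [IsManifold (𝓡 3) ∞ X] [ConnectedSpace X]
    (D : InitialDataSet (𝓡 3) X) (𝒟 : VacuumCauchyDevelopment D)
    (O : Set 𝒟.carrier) (d : FinalStateDecomposition 𝒟.toSpacetime O 4) (R₀ : ℝ),
      O = exteriorOf 𝒟.toCauchyDevelopment d.charted → Hc 𝒟.toSpacetime O 4 d R₀ →
      ∀ (i : Fin d.N) (R₁ τ₁ : ℝ) (W : ℝ → ℝ) (Ψg : (d.background i).domain → 𝒟.carrier),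
        AnalyticGapCert 𝒟.toSpacetime O d R₀ i R₁ τ₁ W Ψg →
        ∃ τ₂ : ℝ, τ₁ ≤ τ₂ ∧ CausalGapClauses 𝒟.toSpacetime O d i R₁ τ₂ W Ψg

/-! ## Registered stubs -/

/-- **Registered stub A (physics, XL, hardest, load-bearing): analytic gap decay.**  See
`AnalyticGapDecay`.  Attack = the route's lever (Huygens at radius `ρ` / cone ledger / KR parametrix;
linear model `…NecksCertifyTwoCap.Exports.huygensNeckLemma` landed). -/
theorem stub_analyticGapDecay : AnalyticGapDecay := by
  sorry

/-- **Registered stub B (Lorentzian causality, L): causal honesty of analytic gap certificates.**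
See `CausalHonesty`. -/
theorem stub_causalHonesty : CausalHonesty := by
  sorry

/-! ## Registered texts of the stubs (the audit admits exactly these names as hypotheses) -/

namespace Registered

/-- Registered text of `stub_analyticGapDecay`. -/
abbrev stub_analyticGapDecay : Prop := AnalyticGapDecay

/-- Registered text of `stub_causalHonesty`. -/
abbrev stub_causalHonesty : Prop := CausalHonesty

end Registered

/-! ## The composition (kernel-checked, no sorry of its own) -/

/-- **Skeleton theorem.**  The two stubs imply the crux `Theses.StarvedNecks.NeckGapDecay` BY NAME:
per hole, the analytic certificate `(R₁, τ₁, W, Ψg)` of stub A is re-issued from the later time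
`τ₂ ≥ τ₁` supplied by stub B together with the causal clauses (G4)(G5); the open-embedding clause is
restricted to the smaller late tube `{τ₂ < t*ᵢ, rᵢ < W(x⁰)+1}` (an open subset of the old one, by
continuity of the boosted Kerr–Schild time). -/
theorem NeckGapDecay_of (hA : Registered.stub_analyticGapDecay) (hB : Registered.stub_causalHonesty) :
    Summit.FinalStateConjecture.FinalStateConjecture.Theses.StarvedNecks.NeckGapDecay := by
  intro X _ _ _ _ D hD 𝒟 h𝒟 O d R₀ hO hc hf hdv i
  obtain ⟨R₁, τ₁, W, Ψg, hcert⟩ := hA X D hD 𝒟 h𝒟 O d R₀ hO hc hf hdv i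
  obtain ⟨τ₂, h12, hG4, hG5⟩ := hB X D 𝒟 O d R₀ hO hc i R₁ τ₁ W Ψg hcert
  obtain ⟨hR, hτ, hW, hmono, hwall, ⟨hsm, hemb, himg⟩, hpin, hdec⟩ := hcert
  refine ⟨R₁, τ₂, W, Ψg, hR, hτ.trans h12, hW, fun s hs ↦ (hwall s (h12.trans hs)).1, ?_, hpin,
    hdec, hG4, hG5⟩
  -- (G1) on the smaller late tube
  have hsub : ({x : (d.background i).domain | τ₂ < (d.background i).time x.1 ∧
      (d.background i).radius x.1 < W (x.1 0) + 1} : Set (d.background i).domain) ⊆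
      {x | τ₁ < (d.background i).time x.1 ∧ (d.background i).radius x.1 < W (x.1 0) + 1} :=
    fun x hx ↦ ⟨lt_of_le_of_lt h12 hx.1, hx.2⟩
  refine ⟨hsm.mono hsub, ?_, (Set.image_mono hsub).trans himg⟩
  have ht : Continuous fun y : {x : (d.background i).domain | τ₁ < (d.background i).time x.1 ∧
      (d.background i).radius x.1 < W (x.1 0) + 1} ↦ (d.background i).time y.1.1 :=
    (continuous_time_boostedKerrBackground _ _ _ _).comp
      (continuous_subtype_val.comp continuous_subtype_val)
  have hopen : IsOpen (Subtype.val ⁻¹' {x : (d.background i).domain |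
      τ₂ < (d.background i).time x.1 ∧ (d.background i).radius x.1 < W (x.1 0) + 1} :
      Set {x : (d.background i).domain | τ₁ < (d.background i).time x.1 ∧
        (d.background i).radius x.1 < W (x.1 0) + 1}) := by
    have : (Subtype.val ⁻¹' {x : (d.background i).domain |
        τ₂ < (d.background i).time x.1 ∧ (d.background i).radius x.1 < W (x.1 0) + 1} :
        Set {x : (d.background i).domain | τ₁ < (d.background i).time x.1 ∧
          (d.background i).radius x.1 < W (x.1 0) + 1}) =
        {y | τ₂ < (d.background i).time y.1.1} := by
      ext y
      exact ⟨fun hy ↦ hy.1, fun hy ↦ ⟨hy, y.2.2⟩⟩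
    rw [this]
    exact isOpen_lt continuous_const ht
  exact hemb.comp (Topology.IsOpenEmbedding.inclusion hsub hopen)

end Summit.FinalStateConjecture.FinalStateConjecture.Cruxes.NeckGapDecay.Birth

end
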